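import Mathlib
import HarnessLib
import Summits.QuantumFields.YangMills.Theses.GronwallGap
import Summits.QuantumFields.YangMills.Theorems.GronwallGapPathGapModulusContinuity

/-!
# `PathGapModulus` (stmt-QuantumFields-13946), line `registered`: the crux in the route's own words —
# "along admissible RP plaquette-weight paths, clustering is lost or degenerates only at (limits of) bulk pressure
# singularities" (lead c5, cycle 6)

Route `GronwallGap`, sub-problem `YangMills`.  A fourth, and the most LOCAL, equivalent form of the crux
`Summit.QuantumFields.YangMills.Theses.GronwallGap.PathGapModulus` (after NoGapCollapse p150915, the trichotomy p153964
and the local trichotomy p161847).  For an admissible weight path `w` call a parameter `s₀ ∈ [0,1]`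

* a CLUSTERING parameter if `UCw w s₀ m` for some `m > 0` (volume-uniform torus clustering at some rate);
* a GOOD parameter if one rate serves a whole relative neighbourhood: `∃ ε μ > 0, ∀ s ∈ [0,1], |s − s₀| < ε → UCw w s μ`;
* a TRANSITION parameter if it is a limit of clustering parameters but is not good (clustering is lost there, or
  survives without a locally uniform rate: the boundary of the massive region together with its critically-slowed points);
* a SINGULAR parameter if the certificate fails there: `¬ AnP (w s₀)` (the torus pressure of `w s₀` is not
  Gateaux-real-analytic in some continuous class-function direction).

`pathGapModulus_iff_transitionsSingular`: **the crux holds iff, for every compact simple `G` and every admissible path,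
every transition parameter is a limit of singular parameters.**  No "analytic pressure at every parameter" hypothesis
survives: the certificate is consulted only near transition parameters.  The mechanism is that admissibility and the
certificate are preserved under RESTRICTION of a path to a subinterval `[a,b] ⊆ [0,1]` followed by affine
reparametrisation (`t ↦ w (a + t(b−a))`: pointwise clauses are inherited, the log-Lipschitz constant becomes `|Λ|(b−a) ≤ |Λ|`,
and the plaquette-weight measure depends on the path only through its value at the parameter), so the global statement
NoGapCollapse on `[0,1]` is equivalent to itself on arbitrarily short parameter intervals around each transition parameter.
(→): if a transition parameter `s₀` had a certificate-regular neighbourhood `(s₀−δ, s₀+δ)`, restrict the path to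
`[max 0 (s₀−δ/2), min 1 (s₀+δ/2)]`; the restricted path is admissible, certified everywhere and has a clustering
parameter (clustering parameters accumulate at `s₀`), so the crux (as NoGapCollapse) gives ONE rate on the whole
subinterval — `s₀` is good, contradiction.  (←): with the certificate everywhere there are no singular parameters, hence
no transition parameters: every limit of clustering parameters is good; so the clustering set is relatively closed, every
clustering parameter is good (local floor), and the abstract continuity-method lemma
`pathGap_uniformFloor_of_localFloor_of_closed` (p150915) turns one clustering parameter into a uniform rate on `[0,1]`.
For the planner: this is the restatement of the crux in the words of the route thesis ("the gap closes only at
thermodynamic singularities"), machine-checked equivalent to the filed decl; for a refuter: a counterexample is ONE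
admissible path, ONE transition parameter and direction-wise real-analytic limiting pressures on a neighbourhood of it.
Pure logic + real arithmetic on the registered statement; no named facts; no definitions.
-/

namespace Summit.QuantumFields.YangMills.Theorems

open scoped BigOperators Topology
open Filter Set MeasureTheory

/-- **`PathGapModulus ↔` every transition parameter of every admissible path is a limit of certificate-singular
parameters** (crux preamble verbatim; "transition" = limit of clustering parameters that is not good, "singular" =
`¬ AnP (w s)`). [folklore] -/
theorem pathGapModulus_iff_transitionsSingular :
    Summit.QuantumFields.YangMills.Theses.GronwallGap.PathGapModulus ↔
    (∀ (G : Type) [Group G] [TopologicalSpace G] [IsTopologicalGroup G] [CompactSpace G],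
      Literature.MathematicalPhysics.QuantumFieldTheory.IsCompactSimpleLieGroup G →
      letI : MeasurableSpace G := borel G; haveI : BorelSpace G := ⟨rfl⟩;
      let UCw : (ℝ → G → ℝ) → ℝ → ℝ → Prop := fun w s m => ∀ A B : Literature.MathematicalPhysics.QuantumFieldTheory.YMSpecies G, ∃ C : ℝ, ∃ S₀ : ℕ, ∀ S : ℕ, S₀ ≤ S → ∀ n : ℕ, n ≤ S → |(∫ U, A.F (Literature.MathematicalPhysics.QuantumLattice.torusLift (2 * S + 1) U) * B.F (Literature.MathematicalPhysics.QuantumLattice.configShift (-Pi.single 0 (n : ℤ)) (Literature.MathematicalPhysics.QuantumLattice.torusLift (2 * S + 1) U)) ∂(Literature.MathematicalPhysics.QuantumLattice.groupHeatKernelMeasure (d := 4) (L := 2 * S + 1) w s)) - (∫ U, A.F (Literature.MathematicalPhysics.QuantumLattice.torusLift (2 * S + 1) U) ∂(Literature.MathematicalPhysics.QuantumLattice.groupHeatKernelMeasure (d := 4) (L := 2 * S + 1) w s)) * (∫ U, B.F (Literature.MathematicalPhysics.QuantumLattice.torusLift (2 * S + 1) U) ∂(Literature.MathematicalPhysics.QuantumLattice.groupHeatKernelMeasure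 (d := 4) (L := 2 * S + 1) w s))| ≤ C * Real.exp (-(m * n));
      let Pseq : (G → ℝ) → ℕ → ℝ := fun v L => (((L + 1 : ℕ) : ℝ) ^ 4)⁻¹ * Real.log (((MeasureTheory.Measure.pi fun _ : Literature.MathematicalPhysics.QuantumFieldTheory.Edge 4 (L + 1) => Literature.MathematicalPhysics.QuantumFieldTheory.haarProbability G).withDensity (fun U : Literature.MathematicalPhysics.QuantumFieldTheory.GaugeConfig 4 (L + 1) G => ENNReal.ofReal (Literature.MathematicalPhysics.QuantumLattice.groupHeatKernelWeight (fun _ : ℝ => v) 0 U))) Set.univ).toReal;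
      let AnP : (G → ℝ) → Prop := fun v => ∀ φ : G → ℝ, Continuous φ → (∀ g h : G, φ (h * g * h⁻¹) = φ g) → ∃ p : ℝ → ℝ, (∀ t : ℝ, Filter.Tendsto (fun L : ℕ => Pseq (fun g => v g * Real.exp (t * φ g)) L) Filter.atTop (nhds (p t))) ∧ AnalyticAt ℝ p 0;
      let Adm : (ℝ → G → ℝ) → Prop := fun w => (∀ s ∈ Set.Icc (0 : ℝ) 1, Continuous (w s) ∧ (∀ g : G, 0 < w s g) ∧ (∀ g h : G, w s (h * g * h⁻¹) = w s g) ∧ (∀ g : G, w s g⁻¹ = w s g) ∧ (∀ (n : ℕ) (x : Fin n → G) (c : Fin n → ℂ), 0 ≤ (∑ i, ∑ j, (starRingEnd ℂ) (c i) * c j * ((w s ((x i)⁻¹ * x j) : ℝ) : ℂ)).re)) ∧ ∃ Λ : ℝ, ∀ s ∈ Set.Icc (0 : ℝ) 1, ∀ s' ∈ Set.Icc (0 : ℝ) 1, ∀ g : G, |Real.log (w s g) - Real.log (w s' g)| ≤ Λ * |s - s'|;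
      ∀ w : ℝ → G → ℝ, Adm w → ∀ s₀ ∈ Set.Icc (0 : ℝ) 1,
        (∀ ε : ℝ, 0 < ε → ∃ s ∈ Set.Icc (0 : ℝ) 1, |s - s₀| < ε ∧ ∃ m : ℝ, 0 < m ∧ UCw w s m) →
        (¬ ∃ ε μ : ℝ, 0 < ε ∧ 0 < μ ∧ ∀ s ∈ Set.Icc (0 : ℝ) 1, |s - s₀| < ε → UCw w s μ) →
        ∀ δ : ℝ, 0 < δ → ∃ s ∈ Set.Icc (0 : ℝ) 1, |s - s₀| < δ ∧ ¬ AnP (w s)) := by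
  have ghkm_congr : ∀ {G : Type} [Group G] [TopologicalSpace G] [IsTopologicalGroup G] [CompactSpace G]
      [MeasurableSpace G] [BorelSpace G] {L : ℕ} [NeZero L]
      {p q : ℝ → G → ℝ} {t t' : ℝ}, p t = q t' →
      Literature.MathematicalPhysics.QuantumLattice.groupHeatKernelMeasure (d := 4) (L := L) p t =
        Literature.MathematicalPhysics.QuantumLattice.groupHeatKernelMeasure (d := 4) (L := L) q t' := by
    intro G _ _ _ _ _ _ L _ p q t t' h
    exact (show Literature.MathematicalPhysics.QuantumLattice.groupHeatKernelMeasure (d := 4) (L := L) p t =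
        Literature.MathematicalPhysics.QuantumLattice.groupHeatKernelMeasure (d := 4) (L := L) (fun _ : ℝ => p t) 0 from rfl).trans
      ((congrArg (fun f : G → ℝ => Literature.MathematicalPhysics.QuantumLattice.groupHeatKernelMeasure (d := 4) (L := L) (fun _ : ℝ => f) 0) h).trans
        (show Literature.MathematicalPhysics.QuantumLattice.groupHeatKernelMeasure (d := 4) (L := L) (fun _ : ℝ => q t') 0 =
          Literature.MathematicalPhysics.QuantumLattice.groupHeatKernelMeasure (d := 4) (L := L) q t' from rfl))
  constructor
  · -- (→): restriction of the path to a certificate-regular neighbourhood of a transition parameter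
    intro hPG G _ _ _ _ hG UCw Pseq AnP Adm w hAdm s₀ hs₀ hcl hng δ hδ
    letI : MeasurableSpace G := borel G
    haveI : BorelSpace G := ⟨rfl⟩
    by_contra hreg
    push Not at hreg
    -- hreg : ∀ s ∈ Icc 0 1, |s - s₀| < δ → AnP (w s)
    set a : ℝ := max 0 (s₀ - δ / 2) with ha
    set b : ℝ := min 1 (s₀ + δ / 2) with hb
    have ha0 : 0 ≤ a := le_max_left _ _
    have hb1 : b ≤ 1 := min_le_left _ _
    have has₀ : a ≤ s₀ := max_le hs₀.1 (by linarith)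
    have hs₀b : s₀ ≤ b := le_min hs₀.2 (by linarith)
    have hab : a < b := by
      rcases le_total 0 (s₀ - δ / 2) with h | h
      · have : a = s₀ - δ / 2 := max_eq_right h
        rcases le_total 1 (s₀ + δ / 2) with h' | h'
        · have : b = 1 := min_eq_left h'; linarith [hs₀.2]
        · have : b = s₀ + δ / 2 := min_eq_right h'; linarith
      · have : a = 0 := max_eq_left h
        rcases le_total 1 (s₀ + δ / 2) with h' | h'
        · have : b = 1 := min_eq_left h'; linarith
        · have : b = s₀ + δ / 2 := min_eq_right h'; linarith [hs₀.1]
    have hba : 0 < b - a := sub_pos.2 hab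
    have hba1 : b - a ≤ 1 := by linarith
    -- points of `[a,b]` are parameters of `[0,1]` within `δ` of `s₀`
    have hIcc_of : ∀ u : ℝ, a ≤ u → u ≤ b → u ∈ Set.Icc (0 : ℝ) 1 ∧ |u - s₀| < δ := by
      intro u hau hub
      refine ⟨⟨ha0.trans hau, hub.trans hb1⟩, ?_⟩
      have h1 : s₀ - δ / 2 ≤ a := le_max_right _ _
      have h2 : b ≤ s₀ + δ / 2 := min_le_right _ _
      rw [abs_lt]; constructor <;> linarith
    have hmem : ∀ t ∈ Set.Icc (0 : ℝ) 1, a ≤ a + t * (b - a) ∧ a + t * (b - a) ≤ b := by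
      intro t ht
      constructor <;> nlinarith [ht.1, ht.2, hba]
    -- the restricted, reparametrised path
    set w' : ℝ → G → ℝ := fun t g => w (a + t * (b - a)) g with hw'
    have hw't : ∀ t : ℝ, w' t = w (a + t * (b - a)) := fun t => rfl
    have hAdm' : Adm w' := by
      refine ⟨fun t ht => ?_, ?_⟩
      · exact hAdm.1 (a + t * (b - a)) (hIcc_of _ (hmem t ht).1 (hmem t ht).2).1
      · obtain ⟨Λ, hΛ⟩ := hAdm.2
        refine ⟨|Λ|, fun t ht t' ht' g => ?_⟩
        have h := hΛ (a + t * (b - a)) (hIcc_of _ (hmem t ht).1 (hmem t ht).2).1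
          (a + t' * (b - a)) (hIcc_of _ (hmem t' ht').1 (hmem t' ht').2).1 g
        have hdist : |a + t * (b - a) - (a + t' * (b - a))| = (b - a) * |t - t'| := by
          rw [show a + t * (b - a) - (a + t' * (b - a)) = (b - a) * (t - t') by ring, abs_mul,
            abs_of_pos hba]
        rw [hdist] at h
        have hΛabs : Λ * ((b - a) * |t - t'|) ≤ |Λ| * |t - t'| := by
          have h0 : 0 ≤ |t - t'| := abs_nonneg _
          calc Λ * ((b - a) * |t - t'|) ≤ |Λ| * ((b - a) * |t - t'|) :=
                mul_le_mul_of_nonneg_right (le_abs_self Λ) (mul_nonneg hba.le h0)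
            _ ≤ |Λ| * (1 * |t - t'|) :=
                mul_le_mul_of_nonneg_left (mul_le_mul_of_nonneg_right hba1 h0) (abs_nonneg Λ)
            _ = |Λ| * |t - t'| := by rw [one_mul]
        exact h.trans hΛabs
    have hAn' : ∀ t ∈ Set.Icc (0 : ℝ) 1, AnP (w' t) := fun t ht =>
      hreg (a + t * (b - a)) (hIcc_of _ (hmem t ht).1 (hmem t ht).2).1 (hIcc_of _ (hmem t ht).1 (hmem t ht).2).2
    -- transport of the clustering predicate between `w'` at `t` and `w` at `a + t(b-a)`
    have hUCw_iff : ∀ (t u : ℝ) (m : ℝ), a + t * (b - a) = u → (UCw w' t m ↔ UCw w u m) := by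
      intro t u m htu
      have key : ∀ S : ℕ,
          Literature.MathematicalPhysics.QuantumLattice.groupHeatKernelMeasure (d := 4) (L := 2 * S + 1) w' t =
            Literature.MathematicalPhysics.QuantumLattice.groupHeatKernelMeasure (d := 4) (L := 2 * S + 1) w u :=
        fun S => ghkm_congr (p := w') (q := w) (t := t) (t' := u) (by rw [hw't, htu])
      constructor
      · intro h A B
        obtain ⟨C, S₁, hC⟩ := h A B
        exact ⟨C, S₁, fun S hS n hn => by rw [← key S]; exact hC S hS n hn⟩
      · intro h A B
        obtain ⟨C, S₁, hC⟩ := h A B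
        exact ⟨C, S₁, fun S hS n hn => by rw [key S]; exact hC S hS n hn⟩
    -- parameter of `[0,1]` for the restricted path corresponding to `u ∈ [a,b]`
    have hparam : ∀ u : ℝ, a ≤ u → u ≤ b →
        (u - a) / (b - a) ∈ Set.Icc (0 : ℝ) 1 ∧ a + (u - a) / (b - a) * (b - a) = u := by
      intro u hau hub
      refine ⟨⟨div_nonneg (sub_nonneg.2 hau) hba.le, ?_⟩, ?_⟩
      · rw [div_le_one hba]; linarith
      · field_simp
        ring
    -- a clustering parameter of the restricted path (clustering parameters accumulate at `s₀`)
    obtain ⟨s₁, hs₁, hs₁d, m₁, hm₁, hU₁⟩ := hcl (δ / 2) (half_pos hδ)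
    have has₁ : a ≤ s₁ := max_le hs₁.1 (by rw [abs_lt] at hs₁d; linarith [hs₁d.1])
    have hs₁b : s₁ ≤ b := le_min hs₁.2 (by rw [abs_lt] at hs₁d; linarith [hs₁d.2])
    obtain ⟨ht₁, ht₁eq⟩ := hparam s₁ has₁ hs₁b
    have hU₁' : UCw w' ((s₁ - a) / (b - a)) m₁ := (hUCw_iff _ _ m₁ ht₁eq).2 hU₁
    -- the crux, as NoGapCollapse, on the restricted path
    obtain ⟨μ, hμ, hall⟩ := (pathGapModulus_iff_noGapCollapse.mp hPG) G hG w' hAdm' hAn'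
      ⟨(s₁ - a) / (b - a), ht₁, m₁, hm₁, hU₁'⟩
    -- hence `s₀` is good with `ε := δ/2` — contradiction
    refine hng ⟨δ / 2, μ, half_pos hδ, hμ, fun s hs hsd => ?_⟩
    have has : a ≤ s := max_le hs.1 (by rw [abs_lt] at hsd; linarith [hsd.1])
    have hsb : s ≤ b := le_min hs.2 (by rw [abs_lt] at hsd; linarith [hsd.2])
    obtain ⟨ht, hteq⟩ := hparam s has hsb
    exact (hUCw_iff _ _ μ hteq).1 (hall _ ht)
  · -- (←): no singular parameters ⇒ no transition parameters ⇒ clopen + local floor ⇒ uniform rate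
    intro hTS
    refine pathGapModulus_iff_noGapCollapse.mpr ?_
    intro G _ _ _ _ hG UCw Pseq AnP Adm w hAdm hAn hex
    have hmono : ∀ s m m', 0 < m' → m' ≤ m → UCw w s m → UCw w s m' :=
      fun s m m' _ hle hU A B => pathGap_clusterBound_antitone hle (hU A B)
    have hGood : ∀ s₀ ∈ Set.Icc (0 : ℝ) 1,
        (∀ ε : ℝ, 0 < ε → ∃ s ∈ Set.Icc (0 : ℝ) 1, |s - s₀| < ε ∧ ∃ m : ℝ, 0 < m ∧ UCw w s m) →
        ∃ ε μ : ℝ, 0 < ε ∧ 0 < μ ∧ ∀ s ∈ Set.Icc (0 : ℝ) 1, |s - s₀| < ε → UCw w s μ := by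
      intro s₀ hs₀ hcl
      by_contra hng
      obtain ⟨s, hs, -, hnA⟩ := hTS G hG w hAdm s₀ hs₀ hcl hng 1 one_pos
      exact hnA (hAn s hs)
    refine pathGap_uniformFloor_of_localFloor_of_closed (P := fun s m => UCw w s m) hmono ?_ ?_ hex
    · intro s₀ hs₀ m₀ hm₀ hP
      exact hGood s₀ hs₀ fun ε hε => ⟨s₀, hs₀, by simpa using hε, m₀, hm₀, hP⟩
    · intro s₀ hs₀ hcl
      obtain ⟨ε, μ, hε, hμ, h⟩ := hGood s₀ hs₀ hcl
      exact ⟨μ, hμ, h s₀ hs₀ (by simpa using hε)⟩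

end Summit.QuantumFields.YangMills.Theorems
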